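import Literature.NumberTheory.Automorphic.LParameter
import Mathlib.Analysis.Normed.Module.Connected
import Mathlib.LinearAlgebra.Complex.FiniteDimensional
import Mathlib.Topology.Instances.Matrix
import Mathlib.Algebra.Polynomial.Roots
import HarnessLib

/-!
# Discharge of `LParameter.componentGroup_subsingleton_of_gl`: for `GL_n` the component groups
# `π₀(S_φ)` of L-parameters are trivial

D-0014 keeps `Literature/` sorry-free by stating cited results as named facts `def X : Prop`.
This sibling file of `Literature.NumberTheory.Automorphic.LParameter` proves its named fact
`LParameter.componentGroup_subsingleton_of_gl F n`: for every L-parameter `φ` of the L-group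
datum `LGroupData.gl F n` (`Ĝ = GL_n(ℂ)`, trivial Galois action) the component group
`π₀(S_φ) = S_φ / S_φ°` of its centralizer is trivial (Gross–Reeder 2010, §3.2; Kaletha 2016, §5.1,
Example: "the centralizer of any L-parameter in `GL_n(ℂ)` is a product of general linear groups,
hence connected").

## The printed argument and its formalisation

For `Ĝ = GL_n(ℂ)` with trivial `Γ_F`-action the centralizer `S_φ` is the set of invertible
elements of the commutant `A = {a ∈ M_n(ℂ) | a m = m a for all m ∈ M}` of the set
`M = {φ(w).left} ∪ {θ(s)} ⊆ M_n(ℂ)` — a `ℂ`-subalgebra of `M_n(ℂ)` (for the printed "product of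
general linear groups" one decomposes the semisimple module; connectedness needs less).  The unit
group of a finite-dimensional `ℂ`-algebra is connected; we prove the path-connectedness of
`S_φ = A ∩ GL_n(ℂ)` directly by the classical one-line argument: for `g₀, g₁ ∈ S_φ` the complex
affine line `g(z) = g₀ + z (g₁ - g₀)` stays inside `A`, and `z ↦ det g(z)` is a non-zero complex
polynomial (`det g(0) = det g₀ ≠ 0`), so it vanishes at finitely many `z`; the complement of a
finite subset of `ℂ ≅ ℝ²` is path-connected (Mathlib
`Set.Countable.isPathConnected_compl_of_one_lt_rank`), so a path from `0` to `1` avoiding the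
zeros gives a path `t ↦ g(γ(t))` from `g₀` to `g₁` inside `S_φ` (continuous for the topology of
`GL_n(ℂ) = M_n(ℂ)ˣ`, inversion being continuous on `GL_n(ℂ)`).  Hence `S_φ` is path-connected,
its identity component is everything, and `π₀(S_φ)` is a singleton.

Main statements:

* `GLCommutant.joinedIn_commutantUnits` — any two invertible matrices commuting with a set `M ⊆ M_n(ℂ)` are
  joined by a path of such matrices; `GLCommutant.isPathConnected_commutantUnits`.
* `LParameter.mem_centralizerGroup_gl_iff` — for `LGroupData.gl F n`, membership in `S_φ` is
  commutation with `M`.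
* `LParameter.pathConnectedSpace_centralizerGroup_gl` — `S_φ` is path-connected.
* `LParameter.componentGroup_subsingleton_of_gl_holds F n` — the discharge.

## References

* B. Gross, M. Reeder, *Arithmetic invariants of discrete Langlands parameters*, Duke Math. J.
  154 (2010), §3.2. [GrossReeder2010]
* T. Kaletha, *The local Langlands conjectures for non-quasi-split groups*, in: Families of
  automorphic forms and the trace formula, Simons Symposia (2016), §5.1, Example. [Kaletha2016]
-/

noncomputable section

open scoped MatrixGroups Matrix unitInterval
open Topology Set

namespace Literature.NumberTheory.Automorphic

/-! ### 1. Invertible elements of a commutant in `M_n(ℂ)` form a path-connected subset of `GL_n(ℂ)` -/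

namespace GLCommutant

variable {n : Type*} [Fintype n] [DecidableEq n]

/-- `z ↦ det (g₀ + z • d)` is a complex polynomial function. [folklore] -/
private theorem exists_polynomial_eval_eq_det_add_smul (g₀ d : Matrix n n ℂ) :
    ∃ P : Polynomial ℂ, ∀ z : ℂ, P.eval z = (g₀ + z • d).det := by
  classical
  refine ⟨(Polynomial.C.mapMatrix g₀ + (Polynomial.X : Polynomial ℂ) • Polynomial.C.mapMatrix d).det,
    fun z => ?_⟩
  have h := RingHom.map_det (Polynomial.evalRingHom z)
    (Polynomial.C.mapMatrix g₀ + (Polynomial.X : Polynomial ℂ) • Polynomial.C.mapMatrix d)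
  rw [Polynomial.coe_evalRingHom] at h
  rw [h]
  congr 1
  ext i j
  simp [Matrix.map_apply]
  ring

/-- **Two invertible matrices commuting with `M` are joined by a path of invertible matrices
commuting with `M`** — along the complex line `g₀ + z (g₁ - g₀)`, avoiding the finitely many `z`
where the determinant vanishes (the complement of a finite subset of `ℂ` is path-connected).
[folklore] -/
private theorem joinedIn_commutantUnits (M : Set (Matrix n n ℂ)) {g₀ g₁ : GL n ℂ}
    (h₀ : ∀ m ∈ M, m * (g₀ : Matrix n n ℂ) = (g₀ : Matrix n n ℂ) * m)
    (h₁ : ∀ m ∈ M, m * (g₁ : Matrix n n ℂ) = (g₁ : Matrix n n ℂ) * m) :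
    JoinedIn {g : GL n ℂ | ∀ m ∈ M, m * (g : Matrix n n ℂ) = (g : Matrix n n ℂ) * m} g₀ g₁ := by
  classical
  set d : Matrix n n ℂ := (g₁ : Matrix n n ℂ) - (g₀ : Matrix n n ℂ) with hd
  -- the line and its determinant polynomial
  let ℓ : ℂ → Matrix n n ℂ := fun z => (g₀ : Matrix n n ℂ) + z • d
  have hℓ0 : ℓ 0 = (g₀ : Matrix n n ℂ) := by simp [ℓ]
  have hℓ1 : ℓ 1 = (g₁ : Matrix n n ℂ) := by simp [ℓ, hd]
  obtain ⟨P, hP⟩ := exists_polynomial_eval_eq_det_add_smul (g₀ : Matrix n n ℂ) d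
  have hdet0 : (ℓ 0).det ≠ 0 := by
    rw [hℓ0]
    exact (Matrix.GeneralLinearGroup.det_ne_zero g₀)
  have hdet1 : (ℓ 1).det ≠ 0 := by
    rw [hℓ1]
    exact (Matrix.GeneralLinearGroup.det_ne_zero g₁)
  have hP0 : P ≠ 0 := by
    intro hP0
    apply hdet0
    rw [← hP 0, hP0, Polynomial.eval_zero]
  -- the bad set is finite, its complement path-connected
  set Z : Set ℂ := {z | (ℓ z).det = 0} with hZ
  have hZfin : Z.Finite := by
    refine (Polynomial.finite_setOf_isRoot hP0).subset fun z hz => ?_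
    simp only [Set.mem_setOf_eq, Polynomial.IsRoot.def, hP z]
    exact hz
  have hZc : IsPathConnected Zᶜ :=
    hZfin.countable.isPathConnected_compl_of_one_lt_rank
      (Complex.rank_real_complex ▸ Nat.one_lt_ofNat)
  have h0Z : (0 : ℂ) ∈ Zᶜ := hdet0
  have h1Z : (1 : ℂ) ∈ Zᶜ := hdet1
  have hJ : JoinedIn Zᶜ (0 : ℂ) 1 := hZc.joinedIn 0 h0Z 1 h1Z
  set γ : Path (0 : ℂ) 1 := hJ.somePath with hγdef
  have hγ : ∀ t, (ℓ (γ t)).det ≠ 0 := fun t => hJ.somePath_mem t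
  -- the path in `GL_n(ℂ)`
  let G : I → GL n ℂ := fun t => Matrix.GeneralLinearGroup.mkOfDetNeZero (ℓ (γ t)) (hγ t)
  have hGval : ∀ t, ((G t : GL n ℂ) : Matrix n n ℂ) = ℓ (γ t) := fun t => rfl
  have hval : Continuous fun t => ((G t : GL n ℂ) : Matrix n n ℂ) := by
    simp only [hGval, ℓ]
    exact continuous_const.add (γ.continuous.smul continuous_const)
  have hG : Continuous G := by
    refine Units.continuous_iff.mpr ⟨hval, ?_⟩
    have e : (fun t => ((G t)⁻¹ : GL n ℂ) : I → Matrix n n ℂ) =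
        fun t => ((G t : GL n ℂ) : Matrix n n ℂ)⁻¹ := by
      funext t
      exact Matrix.coe_units_inv (G t)
    rw [e]
    refine continuous_iff_continuousAt.mpr fun t => ?_
    refine (continuousAt_matrix_inv _ ?_).comp hval.continuousAt
    rw [Ring.inverse_eq_inv']
    exact continuousAt_inv₀ (by rw [hGval]; exact hγ t)
  refine ⟨⟨⟨G, hG⟩, ?_, ?_⟩, fun t => ?_⟩
  · apply Units.ext
    change ((G 0 : GL n ℂ) : Matrix n n ℂ) = _
    rw [hGval, γ.source, hℓ0]
  · apply Units.ext
    change ((G 1 : GL n ℂ) : Matrix n n ℂ) = _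
    rw [hGval, γ.target, hℓ1]
  · -- the line stays inside the commutant
    intro m hm
    change m * ((G t : GL n ℂ) : Matrix n n ℂ) = ((G t : GL n ℂ) : Matrix n n ℂ) * m
    rw [hGval]
    simp only [ℓ, hd, mul_add, add_mul, Matrix.mul_smul, Matrix.smul_mul, mul_sub, sub_mul,
      h₀ m hm, h₁ m hm]

/-- The invertible matrices commuting with `M` form a path-connected subset of `GL_n(ℂ)`.
[folklore] -/
private theorem isPathConnected_commutantUnits (M : Set (Matrix n n ℂ)) :
    IsPathConnected {g : GL n ℂ | ∀ m ∈ M, m * (g : Matrix n n ℂ) = (g : Matrix n n ℂ) * m} :=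
  ⟨1, fun m _ => by simp, fun _ hg => joinedIn_commutantUnits M (fun m _ => by simp) hg⟩

end GLCommutant

/-! ### 2. The centralizer of an L-parameter of `GL_n` is path-connected -/

namespace LParameter

section Split

variable {F : Type*} [Field F] {n : ℕ}

/-- In `ᴸGL_n = GL_n(ℂ) × Γ_F` (trivial Galois action), `(g, 1)` commutes with `x` iff `g`
commutes with the `GL_n(ℂ)`-component of `x`.  Ref: Borel, *Automorphic L-functions*
(Corvallis 1979), §2.4. [folklore] -/
private theorem inl_mul_eq_mul_inl_iff_gl (g : (LGroupData.gl F n).dual) (x : (LGroupData.gl F n).LGroup) :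
    SemidirectProduct.inl g * x = x * SemidirectProduct.inl g ↔ g * x.left = x.left * g := by
  have hga : (LGroupData.gl F n).galAct = 1 := LGroupData.isSplit_gl n
  constructor
  · intro h
    have e := congrArg SemidirectProduct.left h
    simpa [SemidirectProduct.mul_left, hga] using e
  · intro h
    refine SemidirectProduct.ext ?_ ?_
    · simpa [SemidirectProduct.mul_left, hga] using h
    · simp [SemidirectProduct.mul_right]

/-- Two elements of `Ĝ = GL_n(ℂ)` (as the subgroup `⊤`) commute iff their matrices do. [folklore] -/
private theorem dual_mul_comm_iff_gl (u v : (LGroupData.gl F n).dual) :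
    u * v = v * u ↔
      ((u : GL (Fin (LGroupData.gl F n).rank) ℂ) : Matrix (Fin (LGroupData.gl F n).rank) (Fin (LGroupData.gl F n).rank) ℂ) * ((v : GL (Fin (LGroupData.gl F n).rank) ℂ) : Matrix (Fin (LGroupData.gl F n).rank) (Fin (LGroupData.gl F n).rank) ℂ) =
        ((v : GL (Fin (LGroupData.gl F n).rank) ℂ) : Matrix (Fin (LGroupData.gl F n).rank) (Fin (LGroupData.gl F n).rank) ℂ) * ((u : GL (Fin (LGroupData.gl F n).rank) ℂ) : Matrix (Fin (LGroupData.gl F n).rank) (Fin (LGroupData.gl F n).rank) ℂ) := by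
  rw [Subtype.ext_iff, Subgroup.coe_mul, Subgroup.coe_mul, Units.ext_iff, Units.val_mul,
    Units.val_mul]

end Split

variable {F : Type*} [Field F] [ValuativeRel F] [TopologicalSpace F] [IsNonarchimedeanLocalField F]
variable {n : ℕ}

/-- **For `GL_n`, `S_φ` is the set of invertible matrices commuting with the `φ(w)` and the
`θ(s)`**: membership of `g ∈ Ĝ = GL_n(ℂ)` in the centralizer of an L-parameter `φ` of
`LGroupData.gl F n` is commutation of the matrix of `g` with every matrix in
`M = {φ(w).left | w ∈ W_F} ∪ {θ(s) | s ∈ SL₂(ℂ)}`.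
Ref: Gross–Reeder, Duke Math. J. 154 (2010), §3.2; Kaletha (2016), §5.1, Example.
[cite: Kaletha2016, §5.1 Example] -/
theorem mem_centralizerGroup_gl_iff (φ : LParameter (LGroupData.gl F n))
    (g : (LGroupData.gl F n).dual) :
    g ∈ φ.centralizerGroup ↔
      ∀ m ∈ Set.range (fun w : GaloisRepresentations.WeilGroup F =>
            (((φ.φ w).left : GL (Fin (LGroupData.gl F n).rank) ℂ) : Matrix (Fin (LGroupData.gl F n).rank) (Fin (LGroupData.gl F n).rank) ℂ)) ∪
          Set.range (fun s : SL(2, ℂ) => ((φ.θ s : GL (Fin (LGroupData.gl F n).rank) ℂ) : Matrix (Fin (LGroupData.gl F n).rank) (Fin (LGroupData.gl F n).rank) ℂ)),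
        m * ((g : GL (Fin (LGroupData.gl F n).rank) ℂ) : Matrix (Fin (LGroupData.gl F n).rank) (Fin (LGroupData.gl F n).rank) ℂ) =
          ((g : GL (Fin (LGroupData.gl F n).rank) ℂ) : Matrix (Fin (LGroupData.gl F n).rank) (Fin (LGroupData.gl F n).rank) ℂ) * m := by
  rw [mem_centralizerGroup_iff]
  constructor
  · rintro ⟨hw, hs⟩ m (⟨w, rfl⟩ | ⟨s, rfl⟩)
    · exact ((dual_mul_comm_iff_gl _ _).mp (((inl_mul_eq_mul_inl_iff_gl g (φ.φ w)).mp (hw w)).symm))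
    · exact (dual_mul_comm_iff_gl _ _).mp (hs s).symm
  · intro h
    refine ⟨fun w => (inl_mul_eq_mul_inl_iff_gl g (φ.φ w)).mpr ?_, fun s => ?_⟩
    · exact ((dual_mul_comm_iff_gl _ _).mpr (h _ (Set.mem_union_left _ ⟨w, rfl⟩))).symm
    · exact ((dual_mul_comm_iff_gl _ _).mpr (h _ (Set.mem_union_right _ ⟨s, rfl⟩))).symm

/-- **For `GL_n`, the centralizer `S_φ` of an L-parameter is path-connected** (as a subspace of
`Ĝ = GL_n(ℂ)`): it is the set of invertible elements of the commutant of
`M = {φ(w).left} ∪ {θ(s)}`, and any two such are joined along a complex line avoiding the finitely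
many zeros of the determinant (`GLCommutant.isPathConnected_commutantUnits`).
Ref: Gross–Reeder, Duke Math. J. 154 (2010), §3.2; Kaletha (2016), §5.1, Example ("the
centralizer … is a product of general linear groups, hence connected").
[cite: Kaletha2016, §5.1 Example] -/
theorem isPathConnected_centralizerGroup_gl (φ : LParameter (LGroupData.gl F n)) :
    IsPathConnected (φ.centralizerGroup : Set (LGroupData.gl F n).dual) := by
  classical
  set M : Set (Matrix (Fin (LGroupData.gl F n).rank) (Fin (LGroupData.gl F n).rank) ℂ) :=
    Set.range (fun w : GaloisRepresentations.WeilGroup F =>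
        (((φ.φ w).left : GL (Fin (LGroupData.gl F n).rank) ℂ) : Matrix (Fin (LGroupData.gl F n).rank) (Fin (LGroupData.gl F n).rank) ℂ)) ∪
      Set.range (fun s : SL(2, ℂ) => ((φ.θ s : GL (Fin (LGroupData.gl F n).rank) ℂ) : Matrix (Fin (LGroupData.gl F n).rank) (Fin (LGroupData.gl F n).rank) ℂ)) with hM
  rw [Topology.IsInducing.subtypeVal.isPathConnected_iff]
  have himage : Subtype.val '' (φ.centralizerGroup : Set (LGroupData.gl F n).dual) =
      {g : GL (Fin (LGroupData.gl F n).rank) ℂ | ∀ m ∈ M, m * (g : Matrix (Fin (LGroupData.gl F n).rank) (Fin (LGroupData.gl F n).rank) ℂ) =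
        (g : Matrix (Fin (LGroupData.gl F n).rank) (Fin (LGroupData.gl F n).rank) ℂ) * m} := by
    ext x
    constructor
    · rintro ⟨g, hg, rfl⟩
      exact (mem_centralizerGroup_gl_iff φ g).mp hg
    · intro hx
      exact ⟨⟨x, Subgroup.mem_top x⟩, (mem_centralizerGroup_gl_iff φ _).mpr hx, rfl⟩
  convert GLCommutant.isPathConnected_commutantUnits M using 1
  exact himage

/-- `S_φ` is a path-connected space (`GL_n` case). [cite: Kaletha2016, §5.1 Example] -/
theorem pathConnectedSpace_centralizerGroup_gl (φ : LParameter (LGroupData.gl F n)) :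
    PathConnectedSpace φ.centralizerGroup :=
  isPathConnected_iff_pathConnectedSpace.mp (isPathConnected_centralizerGroup_gl φ)

/-- `S_φ° = S_φ` (`GL_n` case): the identity component of the centralizer is everything.
[cite: Kaletha2016, §5.1 Example] -/
theorem connectedComponentOfOne_centralizerGroup_gl_eq_top (φ : LParameter (LGroupData.gl F n)) :
    Subgroup.connectedComponentOfOne φ.centralizerGroup = ⊤ := by
  haveI := pathConnectedSpace_centralizerGroup_gl φ
  refine Subgroup.ext fun g => ⟨fun _ => Subgroup.mem_top g, fun _ => ?_⟩
  change g ∈ connectedComponent (1 : φ.centralizerGroup)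
  rw [PreconnectedSpace.connectedComponent_eq_univ]
  exact Set.mem_univ g

variable (F) in
/-- **Discharge of `LParameter.componentGroup_subsingleton_of_gl`**: for `GL_n` the component
group `π₀(S_φ) = S_φ / S_φ°` of every L-parameter is trivial — `S_φ` is the group of invertible
elements of the commutant of `{φ(w).left} ∪ {θ(s)}` in `M_n(ℂ)`, which is path-connected
(`isPathConnected_centralizerGroup_gl`), so `S_φ° = S_φ`.
Ref: Gross–Reeder, Duke Math. J. 154 (2010), §3.2; Kaletha (2016), §5.1, Example.
[cite: Kaletha2016, §5.1 Example] [cite: GrossReeder2010, §3.2] -/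
theorem componentGroup_subsingleton_of_gl_holds (n : ℕ) : componentGroup_subsingleton_of_gl F n := by
  intro φ
  change Subsingleton (φ.centralizerGroup ⧸ Subgroup.connectedComponentOfOne φ.centralizerGroup)
  rw [connectedComponentOfOne_centralizerGroup_gl_eq_top]
  exact QuotientGroup.subsingleton_quotient_top

end LParameter

end Literature.NumberTheory.Automorphic

end
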